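import Summits.Parity.GeneralizedHardyLittlewood.Theorems.LeeYangFibresRelativeDimOneMoebiusSplitMoebiusTermBVAux7
import Summits.Parity.GeneralizedHardyLittlewood.Theorems.LeeYangFibresRelativeDimOneMoebiusSplitMoebiusTermBVAux2
import Summits.Parity.GeneralizedHardyLittlewood.Theorems.LeeYangFibresRelativeDimOneMoebiusSplitMoebiusTermBVAux8
import Literature.NumberTheory.LFunctions.MatomakiRadziwillTaoProp24
import HarnessLib

/-!
# Route `LeeYangFibres`, crux `RelativeDimOne` (stmt-Parity-14113), line `single-moebius-split`:
# the stub `stub_moebiusTermBV` (T0' — the pure-Möbius term is `o(N)`)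

`stub_moebiusTermBV : ∀ k, MoebiusTermBound k`: for level exponents `δ_i > 0` with
`2 ∑_{i ≥ 1} δ_i < δ_0` and `∑_i δ_i ≤ 1/4`, uniformly over non-degenerate `d = 1` systems
`Ψ = (ψ₀, …, ψ_k)` of size `‖Ψ‖_N ≤ L` and convex `K ⊆ [-N, N]`,
`|∑_{n ∈ K∩ℤ} (Λ − Λ_{R_0})(ψ₀(n)) ∏_{i ≥ 1} Λ_{R_i}(ψ_i(n))| ≤ ε N` for `N ≥ N₀(k, L, δ, ε)`,
`R_i = N^{δ_i}`.

This file is pure asymptotic bookkeeping on top of the two analytic inputs of the line: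

* helper file 7, `moebiusTermSum_le_explicit` — the explicit bound for the pure-Möbius term in terms of
  a modulus-wise majorant `G` of the prime discrepancies `|ψ(w; q, u) − w/φ(q)|`, the number of sieve
  tuples `P = ∏_{i ≥ 1} ⌊R_i⌋`, the largest modulus `Q_m = L P`, the Möbius range `R_min` and the
  Goldston–Yıldırım saving `C e^{−c√log R_min}`;
* helper file 2, `bvLambda_sup` — the Bombieri–Vinogradov theorem for primes with such a majorant,
  `∑_{q ≤ x^{1/2}(log x)^{−B}} G(q) ≤ C' x (log x)^{−A}`, here with `x = X = 2LN` and
  `A = 2k + 2 + 2^{2k+1}`.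

With `s = ∑_{i ≥ 1} δ_i` one has `P ≤ N^s`, `Q_m ≤ L N^s ≤ X^{1/2}(log X)^{−B}` (as `s < 1/12`),
`R_min = R_0/Q_m ≥ Q_m` (this is where `2s < δ_0` enters) and `log R_min ≥ ((δ_0 − s)/2) log N`; the
four terms of the explicit bound are then `≪ N (log N)^{−1}`, `≪ N^{2s} (log N)^{k+2}`,
`≪ N (log N)^{k + 2^{k+1}} e^{−c√(η log N)}` and `≪ N^{s + δ_0} (log N)^{k+1}`, each `≤ (ε/4) N` for
large `N` by the growth lemmas of helper file 8.

References: D. A. Goldston, C. Y. Yıldırım, Integers 3 (2003) A5, Thm. 1.1 [GoldstonYildirim2001];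
H. Iwaniec, E. Kowalski, *Analytic Number Theory* (2004), Thm. 17.1 [IwaniecKowalski2004];
B. Green, T. Tao, Ann. of Math. 171 (2010), App. D [GreenTao2010].
-/

noncomputable section

open Filter Finset Literature.NumberTheory.Sieve

namespace Summit.Parity.GeneralizedHardyLittlewood.Cruxes.RelativeDimOne.SingleMoebiusSplit

open Literature.NumberTheory.Sieve.BVMoebius (eventually_log_rpow_le_rpow')
open Literature.NumberTheory.LFunctions.MRT2015 (natLog_two_le_two_mul_log)

/-- **T0' — the pure-Möbius term is `o(N)`** (`stub_moebiusTermBV` of the line `single-moebius-split`):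
for level exponents `δ_i > 0` with `2 ∑_{i ≥ 1} δ_i < δ_0` and `∑_i δ_i ≤ 1/4`, uniformly over
non-degenerate `d = 1` systems of `k + 1` forms of size `≤ L` and convex `K ⊆ [-N, N]`,
`|∑_{n ∈ K∩ℤ} (Λ − Λ_{R_0})(ψ₀(n)) ∏_{i ≥ 1} Λ_{R_i}(ψ_i(n))| ≤ ε N` for `N ≥ N₀(k, L, δ, ε)`, `R_i = N^{δ_i}`.
Proof: the explicit bound `moebiusTermSum_le_explicit` (helper file 7) fed with the Bombieri–Vinogradov
majorant of `bvLambda_sup` (helper file 2) at `X = 2LN`, saving `A = 2k + 2 + 2^{2k+1}` logarithms, with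
`P = ∏_{i ≥ 1} ⌊R_i⌋ ≤ N^s` tuples (`s = ∑_{i ≥ 1} δ_i`), moduli `≤ Q_m = L P ≤ X^{1/2}(log X)^{−B}`, Möbius
range `R_min = R_0/Q_m ≥ Q_m` (this is where `2s < δ_0` enters) with `log R_min ≥ ((δ_0 − s)/2) log N`;
the four resulting terms are `≪ N/log N`, `≪ N^{2s}(log N)^{k+2}`, `≪ N (log N)^{k+2^{k+1}} e^{−c√(η log N)}`
and `≪ N^{s+δ_0} (log N)^{k+1}`, each `≤ (ε/4) N` for large `N` (helper file 8).
(Bombieri–Vinogradov: Iwaniec–Kowalski, Thm. 17.1.) [cite: GoldstonYildirim2001, Theorem 1.1] -/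
theorem stub_moebiusTermBV : ∀ k : ℕ, MoebiusTermBound k := by
  intro k L δ hδ h2s hsum ε hε
  classical
  rcases Nat.eq_zero_or_pos L with hL0 | hL1
  · -- no non-degenerate system has size `≤ 0`
    refine ⟨1, fun N hN Ψ hΨ hsize K _ _ => ?_⟩
    exfalso
    have h := (natAbs_le_of_affLinSize_le hN hsize 0).1
    rw [hL0, Nat.le_zero, Int.natAbs_eq_zero] at h
    apply hΨ.1 0
    funext j
    rw [Fin.fin_one_eq_zero j, h]
    rfl
  obtain ⟨c, C, hc, hC, hexp⟩ := moebiusTermSum_le_explicit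
  -- the exponents: `s = ∑_{i ≥ 1} δ_i`, `2s < δ_0`, `δ_0 + s ≤ 1/4`
  set s : ℝ := ∑ i : Fin k, δ i.succ with hs
  have hs0 : 0 ≤ s := Finset.sum_nonneg fun i _ => (hδ i.succ).le
  have hδs : δ 0 + s ≤ 1 / 4 := by
    have : ∑ i, δ i = δ 0 + s := Fin.sum_univ_succ δ
    linarith
  have hδle : ∀ i, δ i ≤ 1 := fun i =>
    (Finset.single_le_sum (f := δ) (fun j _ => (hδ j).le) (Finset.mem_univ i)).trans
      (hsum.trans (by norm_num))
  have hδ00 := hδ 0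
  have hη0 : 0 < (δ 0 - s) / 2 := by linarith
  -- Bombieri–Vinogradov input along `X = 2 L N`
  obtain ⟨B, C', hBV⟩ := bvLambda_sup ((2 * k + 2 + 2 ^ (2 * k + 1) : ℕ) : ℝ)
  have hXt : Tendsto (fun N : ℕ => ((2 * L * N : ℕ) : ℝ)) atTop atTop :=
    tendsto_natCast_atTop_atTop.comp
      (tendsto_atTop_mono (fun N => Nat.le_mul_of_pos_left N (by omega)) tendsto_id)
  have hLC : (0 : ℝ) < 4 * (2 * (L : ℝ) * C * (L : ℝ) ^ k * 3 ^ (2 ^ (k + 1)) + 1) := by positivity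
  have hev : ∀ᶠ N : ℕ in atTop, ∀ Ψ : Fin (k + 1) → AffLinForm 1, IsNondegenerateSystem Ψ →
      affLinSize Ψ N ≤ L → ∀ K : Set (Fin 1 → ℝ), Convex ℝ K → K ⊆ realBox 1 N →
        |moebiusTermSum Ψ K N (fun i => (N : ℝ) ^ (δ i))| ≤ ε * N := by
    filter_upwards [hXt.eventually hBV,
      hXt.eventually (eventually_log_rpow_le_rpow' B (by norm_num : (0 : ℝ) < 1 / 8)),
      eventually_le_rpow_nat (L : ℝ) (s := 1 / 4 - s) (by linarith),
      eventually_le_rpow_nat ((L : ℝ) ^ 2) (s := δ 0 - 2 * s) (by linarith),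
      eventually_le_log_nat (Real.log L / ((δ 0 - s) / 2)),
      eventually_le_log_nat (1536 * 3 ^ (2 ^ (2 * k + 1)) * (L : ℝ) ^ (2 * k + 2) * |C'| / ε ^ 2),
      mtb_eventually_log_pow_mul_rpow_le (k + 2) (s + s) (10 * L) (ε / 4) (by linarith) (by positivity),
      eventually_log_pow_mul_exp_neg_sqrt_le (k + 2 ^ (k + 1)) c ((δ 0 - s) / 2)
        (ε / (4 * (2 * (L : ℝ) * C * (L : ℝ) ^ k * 3 ^ (2 ^ (k + 1)) + 1))) hc hη0 (div_pos hε hLC),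
      mtb_eventually_log_pow_mul_rpow_le (k + 1) (s + δ 0) 2 (ε / 4) (by linarith) (by positivity),
      eventually_le_log_nat (1 : ℝ), eventually_ge_atTop (2 * L)] with N hE1 hE2 hE3 hE4 hE5 hE6 hE7
      hE8 hE9 hE10 hN2L
    intro Ψ hΨ hsize K hK hKN
    -- basic facts about `N`
    have hN1 : 1 ≤ N := le_trans (by omega) hN2L
    have hNr1 : (1 : ℝ) ≤ N := by exact_mod_cast hN1
    have hN0 : (0 : ℝ) < N := by positivity
    have hℓ1 : (1 : ℝ) ≤ Real.log N := hE10
    have hE5' : Real.log L ≤ (δ 0 - s) / 2 * Real.log N := by rwa [div_le_iff₀' hη0] at hE5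
    -- the parameters of the explicit bound
    set R : Fin (k + 1) → ℝ := fun i => (N : ℝ) ^ (δ i) with hR
    set P : ℕ := ∏ i : Fin k, ⌊R i.succ⌋₊ with hP
    set Qm : ℕ := L * P with hQm
    set X : ℕ := 2 * L * N with hX
    obtain ⟨G, hG0, hGpt, hGtriv, hGsum⟩ := hE1
    set S : ℝ := C' * (X : ℝ) / Real.log (X : ℝ) ^ ((2 * k + 2 + 2 ^ (2 * k + 1) : ℕ) : ℝ) with hS
    have hR1 : ∀ i, 1 ≤ R i := fun i => Real.one_le_rpow hNr1 (hδ i).le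
    have hlogRle : ∀ i, Real.log (R i) ≤ Real.log N := fun i => by
      rw [hR, Real.log_rpow hN0]
      exact mul_le_of_le_one_left (by linarith) (hδle i)
    have hPs : (P : ℝ) ≤ (N : ℝ) ^ s := prod_natFloor_rpow_le (fun i : Fin k => δ i.succ) hNr1
    have hP1 : 1 ≤ P :=
      Nat.one_le_iff_ne_zero.2 (Finset.prod_pos fun i _ => Nat.floor_pos.2 (hR1 i.succ)).ne'
    have hQm1 : 1 ≤ Qm := Nat.mul_pos hL1 hP1
    have hQr : (Qm : ℝ) = L * P := by rw [hQm, Nat.cast_mul]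
    have hQs : (Qm : ℝ) ≤ L * (N : ℝ) ^ s := by
      rw [hQr]; exact mul_le_mul_of_nonneg_left hPs (Nat.cast_nonneg _)
    have hXr : (X : ℝ) = 2 * (L : ℝ) * (N : ℝ) := by rw [hX]; push_cast; ring
    -- the Möbius range, the level of distribution, the logarithms
    obtain ⟨hRmin1, hRQ, hQR, hlogRmin⟩ :=
      mtb_rmin L N P (δ 0) s ((δ 0 - s) / 2) (Real.log N) hN1 hL1 hP1 hPs hE4 rfl rfl hE5'
    have hrange : Qm ≤ ⌊(X : ℝ) ^ (1 / 2 : ℝ) / Real.log (X : ℝ) ^ B⌋₊ :=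
      Nat.le_floor (mtb_range_le L N s B Qm hL1 hN2L (Nat.cast_nonneg _) hQs hE2 hE3)
    have hsub : Finset.Icc 1 Qm ⊆ Finset.Icc 1 ⌊(X : ℝ) ^ (1 / 2 : ℝ) / Real.log (X : ℝ) ^ B⌋₊ :=
      Finset.Icc_subset_Icc_right hrange
    obtain ⟨hℓΛ, hΛ, hlQ0, hlQ⟩ := mtb_logs L N Qm s hL1 hN2L hℓ1 hQm1 hQs (by linarith)
    have hS0 : 0 ≤ S := (Finset.sum_nonneg fun q _ => hG0 q).trans hGsum
    -- the explicit bound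
    have hbound := hexp k Ψ K L N X P Qm R (Real.log N) ((N : ℝ) ^ (δ 0) / ((L * P : ℕ) : ℝ)) S G hΨ
      hsize hK hKN hN1 rfl rfl rfl hR1 (by linarith) (fun i => hlogRle i.succ) hRmin1 hRQ hQR hG0
      (fun q hq w hw1 hwX u => hGpt q (hsub hq) w hw1 (by exact_mod_cast hwX) u)
      (fun q hq => hGtriv q (hsub hq))
      ((Finset.sum_le_sum_of_subset_of_nonneg hsub fun q _ _ => hG0 q).trans hGsum)
    -- the four terms
    have h1 : Real.log N ^ k * (2 * ((L : ℝ) ^ k * Real.sqrt (3 * (X : ℝ) * Real.log X *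
        (1 + Real.log Qm) ^ (2 ^ (2 * k + 1))) * Real.sqrt S)) ≤ ε / 4 * N :=
      mtb_t1_le k (2 ^ (2 * k + 1)) (2 * k + 2 + 2 ^ (2 * k + 1)) (Real.log N) (Real.log X) L N
        (1 + Real.log Qm) X S C' ε hℓ1 hℓΛ hΛ (by linarith) hlQ hXr (Nat.cast_nonneg _) hN0.le hS0
        (le_of_eq (by rw [hS, Real.rpow_natCast])) rfl hε hE6
    have h2 : Real.log N ^ k * ((P : ℝ) * ((Qm : ℝ) * ((Nat.log 2 X : ℕ) + 1) * Real.log X)) ≤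
        ε / 4 * N :=
      mtb_t2_le k (Real.log N) (Real.log X) L P Qm (Nat.log 2 X) ((N : ℝ) ^ s) ((N : ℝ) ^ (s + s)) ε N
        hℓ1 (by linarith) hΛ (Nat.cast_nonneg _) (Nat.cast_nonneg _) hPs hQr (Nat.cast_nonneg _)
        (natLog_two_le_two_mul_log X) (by rw [Real.rpow_add hN0]) hE7
    have h3 : Real.log N ^ k * ((X : ℝ) * (C * Real.exp (-c * Real.sqrt (Real.log
        ((N : ℝ) ^ (δ 0) / ((L * P : ℕ) : ℝ))))) * ((L : ℝ) ^ k * (1 + Real.log Qm) ^ (2 ^ (k + 1)))) ≤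
        ε / 4 * N :=
      mtb_t3_le k (2 ^ (k + 1)) (Real.log N) X L N C c _ ((δ 0 - s) / 2) (1 + Real.log Qm) ε
        (by linarith) hXr (Nat.cast_nonneg _) hN0.le hC hc.le hlogRmin (by linarith) hlQ hε.le hE8
    have h4 : Real.log N ^ k * ((P : ℝ) * (R 0 * (Real.log (R 0) + 1))) ≤ ε / 4 * N :=
      mtb_t4_le k (Real.log N) P ((N : ℝ) ^ s) (R 0) (Real.log (R 0)) ((N : ℝ) ^ (s + δ 0)) ε N hℓ1
        (Nat.cast_nonneg _) hPs (zero_le_one.trans (hR1 0)) (Real.log_nonneg (hR1 0)) (hlogRle 0)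
        (by rw [Real.rpow_add hN0]) hE9
    rw [mul_add, mul_add, mul_add] at hbound
    linarith
  obtain ⟨N₀, hN₀⟩ := Filter.eventually_atTop.1 hev
  exact ⟨N₀, hN₀⟩

end Summit.Parity.GeneralizedHardyLittlewood.Cruxes.RelativeDimOne.SingleMoebiusSplit
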